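import Summits.ValiantsHypothesis.ValiantsHypothesis.Theorems.KPlusLogSqLawTropicalBHessenbergBlocks

/-!
# Route «KPlusLogSqLaw», crux `TropicalB` (stmt-ValiantsHypothesis-19771) — bounded up-jump supports (`a ≤ b + u`):
# the image of a column interval has one of `≤ ((2u+1)(m+1)^{2u})²` shapes

HONEST FRAMING.  Helper file toward the registered stubs `stub_tropThin` / `stub_tropFat` of `Cruxes/TropicalB/Lines/birth.lean`
(crux `TropicalB`, item stmt-ValiantsHypothesis-19771, route KPlusLogSqLaw, DRAFT; seat val-sym-trop-p5).  It prepares the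
generalisation of the Hessenberg sector theorem (`KPlusLogSqLawTropicalBHessenberg.lean`, up-jumps `≤ 1`) to supports with up-jumps
`≤ u`: `ε a b l ≠ 0 → a ≤ b + u` (the entry in row `a`, column `b` may be present only if `a ≤ b + u`; `u = 1` is p1's
`IsHessenberg`).  Nothing here proves any part of a stub; nothing asserts `TropicalB`, `MatrixDescartes` (stmt-18050) or anything
about VP ≠ VNP.

CONTENT (all [folklore]; Gusfield's state count for unit flows of bounded «up-width»).  For a present term `p = (σ, λ)` of such a
design, `σ i ≤ i + u` for all columns `i` (`row_le_add_of_present`).  Hence at every cut `a` at most `u` columns below the cut are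
sent above it (`card_cross_up_le`), and — by the balance of a permutation across a cut (`card_cross_down_eq_card_cross_up`) — at
most `u` columns above the cut are sent below it.  Consequently the image `R = σ([a, t))` of a column interval differs from `[a, t)`
by at most `2u` removed and `2u` added rows, i.e. `R ∈ shapes m u a t` (`image_mem_shapes`), a finite family with
`#shapes ≤ ((2u+1)·(m+1)^{2u})²` (`card_shapes_le`) — polynomially many CUT STATES for fixed `u`, against `C(m, t)` for general
supports.  The sector theorem itself (recursion over (interval, image) pairs by the sub-additivity
`IntervalOpt.card_optRestr_union_le`) is the sibling file `KPlusLogSqLawTropicalBUpperBand.lean`.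
-/

set_option linter.dupNamespace false
set_option autoImplicit false

namespace Summit.ValiantsHypothesis.ValiantsHypothesis.Theorems.KPlusLogSqLaw

open Summit.ValiantsHypothesis.ValiantsHypothesis.Theorems.MatrixDescartes.Negative
open Summit.ValiantsHypothesis.ValiantsHypothesis.Theorems.LacunarySymmetroidMatrixDescartes
open scoped BigOperators
open Finset

namespace IntervalOpt

variable {m K : ℕ} {d : Fin K → ℕ} {v ε : Fin m → Fin m → Fin K → ℤ}

/-! ## 1. Bounded up-jumps and crossings of a cut -/

/-- a present term of a design with up-jumps `≤ u` has `σ i ≤ i + u`. [folklore] -/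
theorem row_le_add_of_present {u : ℕ} (hU : ∀ (a b : Fin m) (l : Fin K), ε a b l ≠ 0 → (a : ℕ) ≤ (b : ℕ) + u)
    {p : Equiv.Perm (Fin m) × (Fin m → Fin K)} (hp : termSign ε p ≠ 0) (i : Fin m) :
    ((p.1 i : Fin m) : ℕ) ≤ (i : ℕ) + u :=
  hU _ _ _ ((termSign_ne_zero_iff ε p).1 hp i)

/-- a column interval `[a, c)` has at most `c − a` columns. [folklore] -/
theorem card_ico_le (a c : ℕ) : (ico m a c).card ≤ c - a := by
  calc (ico m a c).card = ((ico m a c).image fun i : Fin m => (i : ℕ)).card :=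
        (Finset.card_image_of_injective _ Fin.val_injective).symm
    _ ≤ (Finset.Ico a c).card := by
        refine Finset.card_le_card fun n hn => ?_
        obtain ⟨i, hi, rfl⟩ := Finset.mem_image.1 hn
        rw [mem_ico] at hi
        exact Finset.mem_Ico.2 hi
    _ = c - a := Nat.card_Ico a c

/-- **Balance across a cut.**  For a permutation `σ` of `Fin m` and a cut `a`, the number of columns `≥ a` sent to rows `< a`
equals the number of columns `< a` sent to rows `≥ a`. [folklore] -/
theorem card_cross_down_eq_card_cross_up (σ : Equiv.Perm (Fin m)) (a : ℕ) :
    (Finset.univ.filter fun i : Fin m => a ≤ (i : ℕ) ∧ ((σ i : Fin m) : ℕ) < a).card =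
      (Finset.univ.filter fun i : Fin m => (i : ℕ) < a ∧ a ≤ ((σ i : Fin m) : ℕ)).card := by
  classical
  -- columns sent below the cut: exactly as many as rows below the cut, i.e. as columns below the cut
  have h1 : (Finset.univ.filter fun i : Fin m => ((σ i : Fin m) : ℕ) < a).card =
      (Finset.univ.filter fun j : Fin m => (j : ℕ) < a).card := by
    have he : (Finset.univ.filter fun i : Fin m => ((σ i : Fin m) : ℕ) < a) =
        (Finset.univ.filter fun j : Fin m => (j : ℕ) < a).image σ.symm := by
      ext i
      simp only [Finset.mem_filter, Finset.mem_univ, true_and, Finset.mem_image]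
      constructor
      · intro h
        exact ⟨σ i, h, by simp⟩
      · rintro ⟨j, hj, rfl⟩
        simpa using hj
    rw [he, Finset.card_image_of_injective _ σ.symm.injective]
  -- split both counts at the cut
  have h2 := Finset.card_filter_add_card_filter_not
    (s := Finset.univ.filter fun i : Fin m => ((σ i : Fin m) : ℕ) < a) (fun i : Fin m => (i : ℕ) < a)
  have h3 := Finset.card_filter_add_card_filter_not
    (s := Finset.univ.filter fun j : Fin m => (j : ℕ) < a) (fun i : Fin m => ((σ i : Fin m) : ℕ) < a)
  rw [Finset.filter_filter, Finset.filter_filter] at h2 h3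
  have e1 : (Finset.univ.filter fun i : Fin m => ((σ i : Fin m) : ℕ) < a ∧ (i : ℕ) < a) =
      (Finset.univ.filter fun i : Fin m => (i : ℕ) < a ∧ ((σ i : Fin m) : ℕ) < a) := by
    ext i
    simp only [Finset.mem_filter, Finset.mem_univ, true_and]
    tauto
  have e2 : (Finset.univ.filter fun i : Fin m => ((σ i : Fin m) : ℕ) < a ∧ ¬ (i : ℕ) < a) =
      (Finset.univ.filter fun i : Fin m => a ≤ (i : ℕ) ∧ ((σ i : Fin m) : ℕ) < a) := by
    ext i
    simp only [Finset.mem_filter, Finset.mem_univ, true_and, not_lt]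
    tauto
  have e3 : (Finset.univ.filter fun i : Fin m => (i : ℕ) < a ∧ ¬ ((σ i : Fin m) : ℕ) < a) =
      (Finset.univ.filter fun i : Fin m => (i : ℕ) < a ∧ a ≤ ((σ i : Fin m) : ℕ)) := by
    ext i
    simp only [Finset.mem_filter, Finset.mem_univ, true_and, not_lt]
  rw [e1, e2] at h2
  rw [e3] at h3
  omega

/-- with up-jumps `≤ u`, at most `u` columns below a cut are sent above it (they lie in `[a − u, a)`). [folklore] -/
theorem card_cross_up_le {u : ℕ} {σ : Equiv.Perm (Fin m)} (hrow : ∀ i : Fin m, ((σ i : Fin m) : ℕ) ≤ (i : ℕ) + u)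
    (a : ℕ) : (Finset.univ.filter fun i : Fin m => (i : ℕ) < a ∧ a ≤ ((σ i : Fin m) : ℕ)).card ≤ u := by
  classical
  have hsub : (Finset.univ.filter fun i : Fin m => (i : ℕ) < a ∧ a ≤ ((σ i : Fin m) : ℕ)) ⊆ ico m (a - u) a := by
    intro i hi
    rw [Finset.mem_filter] at hi
    have h1 := hrow i
    rw [mem_ico]
    omega
  calc _ ≤ (ico m (a - u) a).card := Finset.card_le_card hsub
    _ ≤ a - (a - u) := card_ico_le _ _
    _ ≤ u := by omega

/-- with up-jumps `≤ u`, at most `u` columns above a cut are sent below it. [folklore] -/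
theorem card_cross_down_le {u : ℕ} {σ : Equiv.Perm (Fin m)} (hrow : ∀ i : Fin m, ((σ i : Fin m) : ℕ) ≤ (i : ℕ) + u)
    (a : ℕ) : (Finset.univ.filter fun i : Fin m => a ≤ (i : ℕ) ∧ ((σ i : Fin m) : ℕ) < a).card ≤ u := by
  rw [card_cross_down_eq_card_cross_up]
  exact card_cross_up_le hrow a

/-! ## 2. The shapes of the image of a column interval -/

/-- the candidate images of the column interval `[a, t)` for up-jumps `≤ u`: `([a,t) \ X) ∪ W` with `X ⊆ [a, t)`, `#X ≤ 2u`,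
`W` disjoint from `[a, t)`, `#W ≤ 2u`. [folklore] -/
noncomputable def shapes (m u a t : ℕ) : Finset (Finset (Fin m)) :=
  (((ico m a t).powerset.filter fun X => X.card ≤ 2 * u) ×ˢ
    ((Finset.univ \ ico m a t).powerset.filter fun W => W.card ≤ 2 * u)).image fun XW => (ico m a t \ XW.1) ∪ XW.2

/-- subsets of bounded size: `#{X ⊆ s : #X ≤ r} ≤ (r + 1) · (#s + 1)^r`. [folklore] -/
theorem card_filter_powerset_card_le {α : Type*} [DecidableEq α] (s : Finset α) (r : ℕ) :
    (s.powerset.filter fun X => X.card ≤ r).card ≤ (r + 1) * (s.card + 1) ^ r := by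
  have hsub : (s.powerset.filter fun X => X.card ≤ r) ⊆ (Finset.range (r + 1)).biUnion fun j => s.powersetCard j := by
    intro X hX
    rw [Finset.mem_filter, Finset.mem_powerset] at hX
    exact Finset.mem_biUnion.2 ⟨X.card, Finset.mem_range.2 (by omega), Finset.mem_powersetCard.2 ⟨hX.1, rfl⟩⟩
  calc _ ≤ ((Finset.range (r + 1)).biUnion fun j => s.powersetCard j).card := Finset.card_le_card hsub
    _ ≤ ∑ j ∈ Finset.range (r + 1), (s.powersetCard j).card := Finset.card_biUnion_le
    _ ≤ ∑ _j ∈ Finset.range (r + 1), (s.card + 1) ^ r := by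
        refine Finset.sum_le_sum fun j hj => ?_
        rw [Finset.card_powersetCard]
        have hjr : j ≤ r := by rw [Finset.mem_range] at hj; omega
        calc s.card.choose j ≤ s.card ^ j := Nat.choose_le_pow _ _
          _ ≤ (s.card + 1) ^ j := Nat.pow_le_pow_left (Nat.le_succ _) _
          _ ≤ (s.card + 1) ^ r := Nat.pow_le_pow_right (Nat.succ_pos _) hjr
    _ = (r + 1) * (s.card + 1) ^ r := by rw [Finset.sum_const, Finset.card_range, smul_eq_mul]

/-- **Polynomially many shapes**: `#shapes m u a t ≤ ((2u+1)·(m+1)^{2u})²`. [folklore] -/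
theorem card_shapes_le (u a t : ℕ) : (shapes m u a t).card ≤ ((2 * u + 1) * (m + 1) ^ (2 * u)) ^ 2 := by
  classical
  have hm : ∀ s : Finset (Fin m), (s.card + 1) ^ (2 * u) ≤ (m + 1) ^ (2 * u) := fun s =>
    Nat.pow_le_pow_left (Nat.succ_le_succ (by simpa using Finset.card_le_univ s)) _
  have h1 := card_filter_powerset_card_le (ico m a t) (2 * u)
  have h2 := card_filter_powerset_card_le (Finset.univ \ ico m a t) (2 * u)
  have h1' : ((ico m a t).powerset.filter fun X => X.card ≤ 2 * u).card ≤ (2 * u + 1) * (m + 1) ^ (2 * u) :=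
    h1.trans (Nat.mul_le_mul_left _ (hm _))
  have h2' : ((Finset.univ \ ico m a t).powerset.filter fun W => W.card ≤ 2 * u).card ≤ (2 * u + 1) * (m + 1) ^ (2 * u) :=
    h2.trans (Nat.mul_le_mul_left _ (hm _))
  unfold shapes
  calc _ ≤ _ := Finset.card_image_le
    _ = _ := Finset.card_product _ _
    _ ≤ ((2 * u + 1) * (m + 1) ^ (2 * u)) * ((2 * u + 1) * (m + 1) ^ (2 * u)) := Nat.mul_le_mul h1' h2'
    _ = ((2 * u + 1) * (m + 1) ^ (2 * u)) ^ 2 := (sq _).symm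

/-- the shape family is nonempty-sized: `1 ≤ #shapes` (it contains `[a, t)` itself). [folklore] -/
theorem one_le_card_shapes (u a t : ℕ) : 1 ≤ (shapes m u a t).card := by
  classical
  rw [Nat.one_le_iff_ne_zero, Ne, Finset.card_eq_zero, ← Ne, ← Finset.nonempty_iff_ne_empty]
  refine ⟨ico m a t, ?_⟩
  unfold shapes
  refine Finset.mem_image.2 ⟨(∅, ∅), ?_, by simp⟩
  rw [Finset.mem_product, Finset.mem_filter, Finset.mem_filter, Finset.mem_powerset, Finset.mem_powerset]
  exact ⟨⟨Finset.empty_subset _, by simp⟩, Finset.empty_subset _, by simp⟩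

/-- **The image of a column interval is a shape.**  For a permutation with up-jumps `≤ u`, `σ([a, t)) ∈ shapes m u a t`.
[folklore] -/
theorem image_mem_shapes {u : ℕ} {σ : Equiv.Perm (Fin m)} (hrow : ∀ i : Fin m, ((σ i : Fin m) : ℕ) ≤ (i : ℕ) + u)
    (a t : ℕ) : (ico m a t).image σ ∈ shapes m u a t := by
  classical
  set J := ico m a t with hJ
  set R := J.image σ with hR
  -- `W = R \ J` = rows outside `[a,t)` hit from `[a,t)`: above `t` from `≤ u` columns, below `a` from `≤ u` columns
  have hW : (R \ J).card ≤ 2 * u := by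
    have hsplit : R \ J ⊆ ((Finset.univ.filter fun i : Fin m => (i : ℕ) < t ∧ t ≤ ((σ i : Fin m) : ℕ)).image σ) ∪
        ((Finset.univ.filter fun i : Fin m => a ≤ (i : ℕ) ∧ ((σ i : Fin m) : ℕ) < a).image σ) := by
      intro r hr
      rw [Finset.mem_sdiff] at hr
      obtain ⟨i, hi, rfl⟩ := Finset.mem_image.1 hr.1
      rw [hJ, mem_ico] at hi
      have hni : ¬ (a ≤ ((σ i : Fin m) : ℕ) ∧ ((σ i : Fin m) : ℕ) < t) := fun h => hr.2 (by rw [hJ, mem_ico]; exact h)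
      rw [Finset.mem_union, Finset.mem_image, Finset.mem_image]
      rcases Nat.lt_or_ge ((σ i : Fin m) : ℕ) a with hlt | hge
      · exact Or.inr ⟨i, by rw [Finset.mem_filter]; exact ⟨Finset.mem_univ _, hi.1, hlt⟩, rfl⟩
      · exact Or.inl ⟨i, by rw [Finset.mem_filter]; exact ⟨Finset.mem_univ _, hi.2, by omega⟩, rfl⟩
    calc (R \ J).card ≤ _ := Finset.card_le_card hsplit
      _ ≤ _ := Finset.card_union_le _ _
      _ ≤ u + u := Nat.add_le_add (Finset.card_image_le.trans (card_cross_up_le hrow t))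
          (Finset.card_image_le.trans (card_cross_down_le hrow a))
      _ = 2 * u := by ring
  -- `X = J \ R` has the same size as `R \ J`
  have hX : (J \ R).card ≤ 2 * u := by
    have hc : R.card = J.card := Finset.card_image_of_injective _ σ.injective
    have e1 := Finset.card_sdiff_add_card_inter R J
    have e2 := Finset.card_sdiff_add_card_inter J R
    rw [Finset.inter_comm] at e2
    omega
  unfold shapes
  refine Finset.mem_image.2 ⟨(J \ R, R \ J), ?_, ?_⟩
  · rw [Finset.mem_product, Finset.mem_filter, Finset.mem_filter, Finset.mem_powerset, Finset.mem_powerset]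
    exact ⟨⟨Finset.sdiff_subset, hX⟩, Finset.sdiff_subset_sdiff (Finset.subset_univ _) (le_refl _), hW⟩
  · -- `(J \ (J \ R)) ∪ (R \ J) = R`
    ext r
    simp only [Finset.mem_union, Finset.mem_sdiff]
    tauto

end IntervalOpt

end Summit.ValiantsHypothesis.ValiantsHypothesis.Theorems.KPlusLogSqLaw
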